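import Summits.QuantumFields.BalabanUV.T4Continuum.Support.VariationalCovariantTower

/-!
# T⁴ programme, spine node NE2 (U1a), lane P2 — RATE LEMMAS FOR THE END OF THE VARIATIONAL ROUTE'S BACKGROUND TIER (scalar covariant
# species): monotonicity / linearity of the two bracket defects in their small parameters, and `TowerLimitRate` from canonical-pair
# brackets with geometric defects (road owner `b2b-balaban-t4-ne2-p2` gen 11; `t4/skeletons/NE2-t4-ne2-p2.md` v0.9 §0 target R⁺ / §3;
# journal CLAIM «P2-END» CLAIMS.log l.9264; companion END file `VariationalCovariantEnd`)

HONEST FRAMING (T4-DAG p. 1).  Rung (B)+1 only — NOT infinite volume, NOT a mass gap, NOT Clay.  Node NE2 is NOT IN PRINT and NOT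
proved here.  MODEL LEVEL: U(1) bond phases, unit-modulus site transports, frames and the defect data are DATA; scalar (0-form) sector;
what is proved is [folklore] real arithmetic and plumbing over tree theorems (`VariationalCovariantTower` p213109: COMP⁺ transport of
brackets and `towerLimitRate_effSc`); nothing printed is a hypothesis; no `def`; no `def … : Prop` fact; no `sorry`; axioms standard.
HONEST DEPENDENCY (cell, verbatim): continuum YM on T⁴ ⇐ BetaPertH ∧ nine spine estimates (0/9 proved); BetaPertH ⇐ (D1) ∧ (D4) ∧
CAP+tail; G-an2-4 gates asym, D1 and NE2/3/4.

CONTENTS.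
* §1 pure-ℝ RATE LEMMAS for the two defects of the canonical-pair bracket (`VariationalCovariantAssemblySqrt.scalar_pair_bracket_sqrt`,
  p212859): `e(δ, Λ) = 2δ√(Λ·C_P(Λ+1)) + δ²C_P(Λ+1)` (FED⁺ side) and `e′(ε₁, δ′, Λ, C_R) = ε₁C_R(Λ+1) + 2δ′√((Λ + ε₁C_R(Λ+1))·C_P(Λ+1))
  + δ′²C_P(Λ+1)` (ONE⁺/REG⁺ side) are MONOTONE in their arguments and LINEAR-OR-BETTER in the small parameters: if `δ ≤ D·t`,
  `ε₁ ≤ E₁·t`, `δ′ ≤ D′·t` with `0 ≤ t ≤ 1` and `Λ ≤ Λ⋆`, `C_R ≤ C_R⋆`, then `e ≤ E·t`, `e′ ≤ E′·t` with `E`, `E′` the same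
  expressions at the starred constants (`eFED_le`, `eONE_le`); the fine UB⁺ constant of `VariationalCovariantUpperSqrt.fine_ub_of_coarse_sqrt`
  is monotone too (`lamFine_le`); and the CLASS hypotheses at level `n = L^k` — `n·w ≤ c_w` (in-block transport defect), `n²·a ≤ c_a`
  (plaquette defect), `n²·m ≤ c_m` (one-block mismatch), `n²·m₁ ≤ c₁` (one-step defects) — give `t = (L⁻¹)^k = n⁻¹` bounds for
  `δ = √d·(n m)`, `ε₁ = (d/4+½)·L/n²`, `δ′ = √(2d(1+d²))·(n L m₁)` and k-uniform bounds for `Λc = 2d·36^d((1+nw)²+9)`,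
  `C_R = 2Λc + 2d(an²) + d²(an²)²C_P` (`delta_le`, `eps1_le`, `deltaPrime_le`, `LamC_le`, `CR_le`).
* §2 **`towerLimitRate_effSc_of_pairs`**: per-level brackets in the CANONICAL-PAIR form (level `n = L^k` vs. the composite
  `Qk ∘ Q1` / `Sf` presentation of level `k+1`) with defects `e k, e′ k ≤ C·ρ^k`, the COMP⁺ data identities `T (k+1) = compT (T k) (T′ k)`,
  `Rc (k+1) = Rtr (R′ k)`, per-level P⁺-shaped coercivity and unimodular `T k` ⟹ `TowerLimitRate (fun _ ↦ 1) 1 (k ↦ effSc (L^k) M (Rc k) (T k) a) C ρ`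
  — the effective covariant Laplacians CONVERGE on the unit torus at rate `ρ` (`VariationalCovariantTower.bracket_transport` +
  `towerLimitRate_effSc`).  Nothing of NE3.
-/

noncomputable section

open scoped Matrix ComplexConjugate ComplexOrder Matrix.Norms.L2Operator BigOperators

namespace Summit.QuantumFields.BalabanUV.T4Continuum.VariationalCovariantRate

open Summit.QuantumFields.BalabanUV.T4Continuum.VariationalTransfer (blockSpin)
open Summit.QuantumFields.BalabanUV.T4Continuum.VariationalCovariantEffective (effSc)
open Summit.QuantumFields.BalabanUV.T4Continuum.VariationalCovariantTower (compT Rtr bracket_transport towerLimitRate_effSc)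
open Summit.QuantumFields.BalabanUV.T4Continuum.CovariantAveragingTower (TowerLimitRate)
open Literature.MathematicalPhysics.QuantumFieldTheory.Balaban1983to89.B5Prop11Lower (nsq nsq_nonneg)
open Literature.MathematicalPhysics.QuantumFieldTheory.Balaban1983to89.B5Prop11Plancherel (Tor fine)
open Summit.QuantumFields.BalabanUV.T4Continuum.VariationalCovariantScalarPair (Sc Sf qW Qk Q1)

/-! ## §1 Pure-ℝ rate lemmas -/

section Real

/-- **FED⁺-side defect, monotone and linear in the small parameter**: `δ ≤ D·t`, `0 ≤ t ≤ 1`, `Λ ≤ Λ⋆` ⟹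
`2δ√(Λ·C_P(Λ+1)) + δ²·C_P(Λ+1) ≤ (2D√(Λ⋆·C_P(Λ⋆+1)) + D²·C_P(Λ⋆+1))·t`. [folklore] -/
theorem eFED_le {δ D t Λ Λs CP : ℝ} (hδ : 0 ≤ δ) (hδD : δ ≤ D * t) (ht0 : 0 ≤ t) (ht1 : t ≤ 1)
    (hΛ : 0 ≤ Λ) (hΛs : Λ ≤ Λs) (hCP : 0 ≤ CP) :
    2 * δ * Real.sqrt (Λ * (CP * (Λ + 1))) + δ ^ 2 * (CP * (Λ + 1))
      ≤ (2 * D * Real.sqrt (Λs * (CP * (Λs + 1))) + D ^ 2 * (CP * (Λs + 1))) * t := by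
  have hsq : Real.sqrt (Λ * (CP * (Λ + 1))) ≤ Real.sqrt (Λs * (CP * (Λs + 1))) := by
    apply Real.sqrt_le_sqrt
    have h1 : CP * (Λ + 1) ≤ CP * (Λs + 1) := by gcongr
    exact mul_le_mul hΛs h1 (by positivity) (hΛ.trans hΛs)
  have hS0 : 0 ≤ Real.sqrt (Λs * (CP * (Λs + 1))) := Real.sqrt_nonneg _
  have h1 : 2 * δ * Real.sqrt (Λ * (CP * (Λ + 1))) ≤ 2 * (D * t) * Real.sqrt (Λs * (CP * (Λs + 1))) := by
    have := mul_le_mul hδD hsq (Real.sqrt_nonneg _) (hδ.trans hδD)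
    linarith
  have hδ2 : δ ^ 2 ≤ D ^ 2 * t := by
    have hDt : δ ^ 2 ≤ (D * t) ^ 2 := pow_le_pow_left₀ hδ hδD 2
    have ht2 : (D * t) ^ 2 ≤ D ^ 2 * t := by
      rw [mul_pow]
      have : t ^ 2 ≤ t := by nlinarith
      exact mul_le_mul_of_nonneg_left this (sq_nonneg D)
    exact hDt.trans ht2
  have h2 : δ ^ 2 * (CP * (Λ + 1)) ≤ D ^ 2 * t * (CP * (Λs + 1)) := by
    have hc : CP * (Λ + 1) ≤ CP * (Λs + 1) := by gcongr
    exact mul_le_mul hδ2 hc (by positivity) (by positivity)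
  calc _ ≤ 2 * (D * t) * Real.sqrt (Λs * (CP * (Λs + 1))) + D ^ 2 * t * (CP * (Λs + 1)) := add_le_add h1 h2
    _ = (2 * D * Real.sqrt (Λs * (CP * (Λs + 1))) + D ^ 2 * (CP * (Λs + 1))) * t := by ring

/-- **ONE⁺/REG⁺-side defect, monotone and linear in the small parameters**: `ε₁ ≤ E₁·t`, `δ′ ≤ D′·t`, `0 ≤ t ≤ 1`, `Λ ≤ Λ⋆`,
`C_R ≤ C_R⋆` ⟹ `ε₁C_R(Λ+1) + 2δ′√((Λ + ε₁C_R(Λ+1))·C_P(Λ+1)) + δ′²·C_P(Λ+1) ≤ (the same at E₁, D′, Λ⋆, C_R⋆)·t`. [folklore] -/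
theorem eONE_le {ε₁ E₁ δ' D' t Λ Λs CR CRs CP : ℝ} (hε₁E : ε₁ ≤ E₁ * t) (hE₁ : 0 ≤ E₁)
    (hδ' : 0 ≤ δ') (hδ'D : δ' ≤ D' * t) (ht0 : 0 ≤ t) (ht1 : t ≤ 1)
    (hΛ : 0 ≤ Λ) (hΛs : Λ ≤ Λs) (hCR : 0 ≤ CR) (hCRs : CR ≤ CRs) (hCP : 0 ≤ CP) :
    ε₁ * CR * (Λ + 1) + 2 * δ' * Real.sqrt ((Λ + ε₁ * CR * (Λ + 1)) * (CP * (Λ + 1))) + δ' ^ 2 * (CP * (Λ + 1))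
      ≤ (E₁ * CRs * (Λs + 1) + 2 * D' * Real.sqrt ((Λs + E₁ * CRs * (Λs + 1)) * (CP * (Λs + 1)))
          + D' ^ 2 * (CP * (Λs + 1))) * t := by
  have hΛs0 : 0 ≤ Λs := hΛ.trans hΛs
  have hCRs0 : 0 ≤ CRs := hCR.trans hCRs
  have hεE : ε₁ ≤ E₁ := hε₁E.trans (by nlinarith)
  have hin : Λ + ε₁ * CR * (Λ + 1) ≤ Λs + E₁ * CRs * (Λs + 1) := by
    have : ε₁ * CR * (Λ + 1) ≤ E₁ * CRs * (Λs + 1) := by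
      apply mul_le_mul (mul_le_mul hεE hCRs hCR hE₁) (by linarith) (by linarith) (by positivity)
    linarith
  have hsq : Real.sqrt ((Λ + ε₁ * CR * (Λ + 1)) * (CP * (Λ + 1))) ≤ Real.sqrt ((Λs + E₁ * CRs * (Λs + 1)) * (CP * (Λs + 1))) := by
    apply Real.sqrt_le_sqrt
    have h1 : CP * (Λ + 1) ≤ CP * (Λs + 1) := by gcongr
    exact mul_le_mul hin h1 (by positivity) (by positivity)
  have h1 : ε₁ * CR * (Λ + 1) ≤ E₁ * t * CRs * (Λs + 1) := by
    have := mul_le_mul (mul_le_mul hε₁E hCRs hCR (by positivity)) (show Λ + 1 ≤ Λs + 1 by linarith) (by linarith)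
      (by positivity)
    linarith
  have h2 : 2 * δ' * Real.sqrt ((Λ + ε₁ * CR * (Λ + 1)) * (CP * (Λ + 1)))
      ≤ 2 * (D' * t) * Real.sqrt ((Λs + E₁ * CRs * (Λs + 1)) * (CP * (Λs + 1))) := by
    have := mul_le_mul hδ'D hsq (Real.sqrt_nonneg _) (hδ'.trans hδ'D)
    linarith
  have hδ2 : δ' ^ 2 ≤ D' ^ 2 * t := by
    have hDt : δ' ^ 2 ≤ (D' * t) ^ 2 := pow_le_pow_left₀ hδ' hδ'D 2
    have ht2 : (D' * t) ^ 2 ≤ D' ^ 2 * t := by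
      rw [mul_pow]
      have : t ^ 2 ≤ t := by nlinarith
      exact mul_le_mul_of_nonneg_left this (sq_nonneg D')
    exact hDt.trans ht2
  have h3 : δ' ^ 2 * (CP * (Λ + 1)) ≤ D' ^ 2 * t * (CP * (Λs + 1)) := by
    have hc : CP * (Λ + 1) ≤ CP * (Λs + 1) := by gcongr
    exact mul_le_mul hδ2 hc (by positivity) (by positivity)
  calc _ ≤ E₁ * t * CRs * (Λs + 1) + 2 * (D' * t) * Real.sqrt ((Λs + E₁ * CRs * (Λs + 1)) * (CP * (Λs + 1)))
        + D' ^ 2 * t * (CP * (Λs + 1)) := add_le_add (add_le_add h1 h2) h3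
    _ = _ := by ring

/-- the fine UB⁺ constant of `VariationalCovariantUpperSqrt.fine_ub_of_coarse_sqrt`,
`Λ = Λc + (ε₁C_R + 2δ′√((1 + ε₁C_R)·C_P) + δ′²C_P)·(Λc+1)`, is monotone in `(Λc, ε₁, δ′, C_R)`. [folklore] -/
theorem lamFine_le {Λc Λcs ε₁ E₁ δ' D' CR CRs CP : ℝ} (hΛc : 0 ≤ Λc) (hΛcs : Λc ≤ Λcs) (hε₁ : 0 ≤ ε₁) (hε₁E : ε₁ ≤ E₁)
    (hδ' : 0 ≤ δ') (hδ'D : δ' ≤ D') (hCR : 0 ≤ CR) (hCRs : CR ≤ CRs) (hCP : 0 ≤ CP) :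
    Λc + (ε₁ * CR + 2 * δ' * Real.sqrt ((1 + ε₁ * CR) * CP) + δ' ^ 2 * CP) * (Λc + 1)
      ≤ Λcs + (E₁ * CRs + 2 * D' * Real.sqrt ((1 + E₁ * CRs) * CP) + D' ^ 2 * CP) * (Λcs + 1) := by
  have hE₁ : 0 ≤ E₁ := hε₁.trans hε₁E
  have hεC : ε₁ * CR ≤ E₁ * CRs := mul_le_mul hε₁E hCRs hCR hE₁
  have hsq : Real.sqrt ((1 + ε₁ * CR) * CP) ≤ Real.sqrt ((1 + E₁ * CRs) * CP) := by
    apply Real.sqrt_le_sqrt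
    exact mul_le_mul_of_nonneg_right (by linarith) hCP
  have h2 : 2 * δ' * Real.sqrt ((1 + ε₁ * CR) * CP) ≤ 2 * D' * Real.sqrt ((1 + E₁ * CRs) * CP) := by
    have := mul_le_mul hδ'D hsq (Real.sqrt_nonneg _) (hδ'.trans hδ'D)
    linarith
  have h3 : δ' ^ 2 * CP ≤ D' ^ 2 * CP := mul_le_mul_of_nonneg_right (pow_le_pow_left₀ hδ' hδ'D 2) hCP
  have hsum : ε₁ * CR + 2 * δ' * Real.sqrt ((1 + ε₁ * CR) * CP) + δ' ^ 2 * CP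
      ≤ E₁ * CRs + 2 * D' * Real.sqrt ((1 + E₁ * CRs) * CP) + D' ^ 2 * CP := by linarith
  have hpos : 0 ≤ ε₁ * CR + 2 * δ' * Real.sqrt ((1 + ε₁ * CR) * CP) + δ' ^ 2 * CP := by positivity
  have := mul_le_mul hsum (show Λc + 1 ≤ Λcs + 1 by linarith) (by linarith) (hpos.trans hsum)
  linarith

/-- `n⁻¹ = (L⁻¹)^k` at `n = L^k` (as reals). [folklore] -/
theorem inv_pow_level (L k : ℕ) : ((((L ^ k : ℕ) : ℝ)))⁻¹ = ((L : ℝ)⁻¹) ^ k := by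
  push_cast
  rw [inv_pow]

/-- CLASS ⟹ FED⁺ mismatch parameter: `n²·m ≤ c_m`, `1 ≤ n` ⟹ `√d·(n·m) ≤ (√d·c_m)·n⁻¹`. [folklore] -/
theorem delta_le {d : ℕ} {n m cm : ℝ} (hn : 1 ≤ n) (hcls : n ^ 2 * m ≤ cm) :
    Real.sqrt d * (n * m) ≤ (Real.sqrt d * cm) * n⁻¹ := by
  have hn0 : 0 < n := by linarith
  have h : n * m ≤ cm * n⁻¹ := by
    rw [le_mul_inv_iff₀ hn0]
    nlinarith
  have := mul_le_mul_of_nonneg_left h (Real.sqrt_nonneg (d : ℝ))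
  linarith [this]

/-- CLASS ⟹ ONE⁺ consistency parameter: `ε₁ = (d/4+½)·(L/n²) ≤ ((d/4+½)·L)·n⁻¹` for `1 ≤ n`. [folklore] -/
theorem eps1_le {d : ℕ} {n L : ℝ} (hn : 1 ≤ n) (hL : 0 ≤ L) :
    ((d : ℝ) / 4 + 1 / 2) * (L / n ^ 2) ≤ (((d : ℝ) / 4 + 1 / 2) * L) * n⁻¹ := by
  have hn0 : 0 < n := by linarith
  have h : L / n ^ 2 ≤ L * n⁻¹ := by
    rw [div_eq_mul_inv]
    apply mul_le_mul_of_nonneg_left _ hL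
    rw [inv_le_inv₀ (by positivity) hn0]
    nlinarith
  have := mul_le_mul_of_nonneg_left h (show (0 : ℝ) ≤ (d : ℝ) / 4 + 1 / 2 by positivity)
  linarith [this]

/-- CLASS ⟹ ONE⁺ transport parameter: `n²·m₁ ≤ c₁`, `1 ≤ n` ⟹ `√(2d(1+d²))·(n·L·m₁) ≤ (√(2d(1+d²))·L·c₁)·n⁻¹`. [folklore] -/
theorem deltaPrime_le {d : ℕ} {n L m₁ c₁ : ℝ} (hn : 1 ≤ n) (hL : 0 ≤ L) (hcls : n ^ 2 * m₁ ≤ c₁) :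
    Real.sqrt (2 * d * (1 + (d : ℝ) ^ 2)) * (n * L * m₁) ≤ (Real.sqrt (2 * d * (1 + (d : ℝ) ^ 2)) * L * c₁) * n⁻¹ := by
  have hn0 : 0 < n := by linarith
  have h : n * m₁ ≤ c₁ * n⁻¹ := by
    rw [le_mul_inv_iff₀ hn0]
    nlinarith
  have h2 : n * L * m₁ ≤ L * c₁ * n⁻¹ := by
    have := mul_le_mul_of_nonneg_left h hL
    nlinarith [this]
  have := mul_le_mul_of_nonneg_left h2 (Real.sqrt_nonneg (2 * d * (1 + (d : ℝ) ^ 2)))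
  linarith [this]

/-- CLASS ⟹ UB⁺ constant: `0 ≤ n·w ≤ c_w` ⟹ `2d·36^d·((1 + n w)² + 9) ≤ 2d·36^d·((1 + c_w)² + 9)`. [folklore] -/
theorem LamC_le {d : ℕ} {n w cw : ℝ} (hnw : 0 ≤ n * w) (hcls : n * w ≤ cw) :
    2 * (d : ℝ) * (36 : ℝ) ^ d * ((1 + n * w) ^ 2 + 9) ≤ 2 * (d : ℝ) * (36 : ℝ) ^ d * ((1 + cw) ^ 2 + 9) := by
  have h : (1 + n * w) ^ 2 ≤ (1 + cw) ^ 2 := pow_le_pow_left₀ (by linarith) (by linarith) 2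
  have : (1 + n * w) ^ 2 + 9 ≤ (1 + cw) ^ 2 + 9 := by linarith
  exact mul_le_mul_of_nonneg_left this (by positivity)

/-- CLASS ⟹ REG⁺ constant: `0 ≤ a n² ≤ c_a`, `Λc ≤ Λc⋆` ⟹ `2Λc + 2d(an²) + d²(an²)²C_P ≤ 2Λc⋆ + 2d·c_a + d²c_a²·C_P`. [folklore] -/
theorem CR_le {d : ℕ} {Λc Λcs α ca CP : ℝ} (hΛ : Λc ≤ Λcs) (hα : 0 ≤ α) (hcls : α ≤ ca) (hCP : 0 ≤ CP) :
    2 * Λc + 2 * d * α + (d : ℝ) ^ 2 * α ^ 2 * CP ≤ 2 * Λcs + 2 * d * ca + (d : ℝ) ^ 2 * ca ^ 2 * CP := by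
  have h2 : α ^ 2 ≤ ca ^ 2 := pow_le_pow_left₀ hα hcls 2
  have h3 : (d : ℝ) ^ 2 * α ^ 2 * CP ≤ (d : ℝ) ^ 2 * ca ^ 2 * CP := by
    apply mul_le_mul_of_nonneg_right _ hCP
    exact mul_le_mul_of_nonneg_left h2 (by positivity)
  have h1 : 2 * (d : ℝ) * α ≤ 2 * d * ca := by
    exact mul_le_mul_of_nonneg_left hcls (by positivity)
  linarith

end Real

/-! ## §2 The tower rate from canonical-pair brackets with geometric defects -/

section Tower

variable {d : ℕ} (L : ℕ) [NeZero L] (M : Fin d → ℕ) [hM : ∀ μ, NeZero (M μ)]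
variable (Rc : (k : ℕ) → Tor (fine (L ^ k) M) → Fin d → ℂ) (T : (k : ℕ) → Tor (fine (L ^ k) M) → ℂ)
variable (R' : (k : ℕ) → Tor (fine L (fine (L ^ k) M)) → Fin d → ℂ) (T' : (k : ℕ) → Tor (fine L (fine (L ^ k) M)) → ℂ)

/-- **THE η-RATE OF THE EFFECTIVE COVARIANT LAPLACIANS FROM THE CANONICAL-PAIR BRACKETS**: per-level brackets in the pair
presentation (`Δ′_k(μ) = blockSpin (Q_{T_k}) Sc_k μ` vs. `blockSpin (Q_{T_k} ∘ Q₁(T′_k)) Sf_k μ`) with defects `e k, e′ k ≤ C·ρ^k`,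
the COMP⁺ data identities, per-level P⁺-shaped coercivity and unimodular `T k` ⟹
`TowerLimitRate (fun _ ↦ 1) 1 (k ↦ effSc (L^k) M (Rc k) (T k) a) C ρ`: the Hermitian effective operators `X_k` CONVERGE on the unit
torus with `‖X_k − X_∞‖ ≤ C·ρ^k/(1 − ρ)`.  Nothing of NE3. [folklore] -/
theorem towerLimitRate_effSc_of_pairs (hT : ∀ k x, ‖T k x‖ = 1) {CP : ℕ → ℝ}
    (hPc : ∀ k f, qW (L ^ k) M f ≤ CP k * (Sc (L ^ k) M (Rc k) f + nsq (Qk (L ^ k) M (T k) f)))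
    (hTcomp : ∀ k, T (k + 1) = compT (L ^ k) L M (T k) (T' k)) (hRtr : ∀ k, Rc (k + 1) = Rtr (L ^ k) L M (R' k))
    {a : ℝ} (ha : 0 < a) {C ρ : ℝ} (hC : 0 ≤ C) (hρ : 0 ≤ ρ) (hρ1 : ρ < 1) (e e' : ℕ → ℝ)
    (he : ∀ k, e k ≤ C * ρ ^ k) (he' : ∀ k, e' k ≤ C * ρ ^ k)
    (hbr : ∀ k μ, blockSpin (Qk (L ^ k) M (T k)) (Sc (L ^ k) M (Rc k)) μ
        ≤ blockSpin (Qk (L ^ k) M (T k) ∘ Q1 (L ^ k) L M (T' k)) (Sf (L ^ k) L M (R' k)) μ + e k * nsq μ ∧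
      blockSpin (Qk (L ^ k) M (T k) ∘ Q1 (L ^ k) L M (T' k)) (Sf (L ^ k) L M (R' k)) μ
        ≤ blockSpin (Qk (L ^ k) M (T k)) (Sc (L ^ k) M (Rc k)) μ + e' k * nsq μ) :
    TowerLimitRate (ι := fun _ => Tor M) (fun _ => (1 : Matrix (Tor M) (Tor M) ℂ)) 1
      (fun k => effSc (L ^ k) M (Rc k) (T k) a) C ρ := by
  refine towerLimitRate_effSc L M Rc T hT hPc ha hC hρ hρ1 fun k μ => ?_
  have hlev : blockSpin (Qk (L ^ (k + 1)) M (T (k + 1))) (Sc (L ^ (k + 1)) M (Rc (k + 1))) μ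
      = blockSpin (Qk (L ^ k * L) M (compT (L ^ k) L M (T k) (T' k))) (Sc (L ^ k * L) M (Rtr (L ^ k) L M (R' k))) μ := by
    rw [hTcomp k, hRtr k]; rfl
  rw [hlev]
  have h := bracket_transport (L ^ k) L M (hbr k μ)
  have hn : 0 ≤ nsq μ := nsq_nonneg μ
  have h1 : e k * nsq μ ≤ C * ρ ^ k * nsq μ := mul_le_mul_of_nonneg_right (he k) hn
  have h2 : e' k * nsq μ ≤ C * ρ ^ k * nsq μ := mul_le_mul_of_nonneg_right (he' k) hn
  exact ⟨h.1.trans (by linarith), h.2.trans (by linarith)⟩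

end Tower

end Summit.QuantumFields.BalabanUV.T4Continuum.VariationalCovariantRate

end
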